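import Literature.MathematicalPhysics.StatisticalMechanics.Knauf1998.Compute
import HarnessLib

/-!
# Knauf (1998), Sect. 6 — kernel evaluation chunk 5 of 5 for `G₁₅`

Source: A. Knauf, *The number-theoretical spin chain and the Riemann zeroes*, Comm. Math. Phys. **196** (1998)
703–731, doi:10.1007/s002200050441 [Knauf1998], Sect. 6 (Definitions 12, 13 and the Conjecture stated after them);
restated in A. Knauf, *Number theory, dynamical systems and statistical mechanics*, Rev. Math. Phys. **11** (1999)
1027–1060, §4.

`checkA a = true` for `a = 12, 13, 14` (see `Literature.MathematicalPhysics.StatisticalMechanics.Knauf1998.Compute` for WHAT is checked — the eigenvector identity,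
the orbit invariances and the non-incidences, for every element of `SL(2,ℤ/15ℤ)` with first entry `a` — and
`Literature.MathematicalPhysics.StatisticalMechanics.Knauf1998.Eigenvalue` for what it means).  `decide +kernel`: the Lean KERNEL evaluates the closed Boolean terms
(≈ 5 s each); no `native_decide`, no `Lean.ofReduceBool`, standard axioms only.  Five small modules rather than one
so that each elaborates quickly; nothing depends on the split (`checkA_all` in `Transport`).

Provenance: refutations bundle `papers/_cross/refutations` (H21 seat pub-refute-2, 2026-08-18), package module
`Refutations.Knauf1998.Kernel5`, moved into the tree under the Lean-in-tree rule (human 2026-08-18); the eigenvector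
table was GENERATED by that bundle's `tools/knauf_g15_gen.py` (pure Python, exact arithmetic; `--check` re-derives the
data file byte-for-byte) from the 2001 H21 study (archive `summits/rh/routes/knauf-spin-chain-ramanujan`).
-/

namespace Literature.MathematicalPhysics.StatisticalMechanics.Knauf1998.Compute

/-- `checkA 12 = true`, evaluated by the kernel (`decide +kernel`). [folklore] -/
theorem checkA_12 : checkA 12 = true := by decide +kernel

/-- `checkA 13 = true`, evaluated by the kernel (`decide +kernel`). [folklore] -/
theorem checkA_13 : checkA 13 = true := by decide +kernel

/-- `checkA 14 = true`, evaluated by the kernel (`decide +kernel`). [folklore] -/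
theorem checkA_14 : checkA 14 = true := by decide +kernel

end Literature.MathematicalPhysics.StatisticalMechanics.Knauf1998.Compute
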